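import Summits.QuantumFields.BalabanUV.Beta.GAN24.DirichletExhaustionTails
import Literature.MathematicalPhysics.QuantumFieldTheory.Balaban1983to89.B4Reflection242

/-!
# `BalabanUV.Beta.GAN24.DirichletExhaustionDeperiodise` — binder row G-an2-4 / (CONV-C), part P2, PART 20: DE-PERIODISATION — an
# exponentially bounded kernel on `ℤ^{d+1}` is DETERMINED by its periodisations along periods `M → ∞`; the converse of PART 12/13
# (`deltaPol = Σ'_m deltaZ(·, · + M∘m)`, wrap-around tails `→ 0`), with the sockets by which a torus identity
# «periodised kernel `w` = `c·deltaPol M (L^k)`» de-periodises to «`w = c·deltaZ L k`» on `ℤ^{d+1}` (unit b2b-balaban-gan24-p2, gen 4, v1)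

HONEST FRAMING (cell contract, verbatim): «discharging `BetaPertH` makes Bałaban's UV stability UNCONDITIONAL — a real constructive-QFT
result; it is NOT the continuum limit and NOT the Clay problem.»  This file is [folklore] real analysis on `ℤ^{d+1}` (absolutely convergent
re-arrangements and geometric tails).  It asserts NO dictionary between the β-cell's typed `U = 1` system (`Beta/KernelSpecInstance.wΦ`) and
the (1.66) kernel `deltaZ` (PART 8): it supplies the `M → ∞` step such a dictionary needs, as theorems whose torus-side input is an explicit
HYPOTHESIS (the multiplier–multiplier torus identity of the formalisation swarm's row P1-L13b, not proved here, not asserted, no `Prop` minted).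
«not in print; our proof attempt».  NOT the K-slot of (CONV-C), NOT `BetaPertH`, NOT continuum, NOT Clay.

ABSOLUTE RULE (cell, verbatim): «No internally-minted statement may enter as a cited fact. Every hypothesis is either kernel-proved in this
package or a verbatim quotation of a PUBLISHED theorem with page reference. The manuscript(s) under audit are NOT citable for their own disputed
steps — they are the thing under adjudication; programme-internal (2001/route/tribunal) claims are never citable.»

WHAT IS PROVED (0 sorry, no `def`):
* §0 lattice bookkeeping: `translate_zero`, `translate_const_eq_add_nsmul` / `_zsmul` / `_scalar` (a scalar period `M₀` is the constant period vector:
  `translate (fun _ => M₀) z t = z + M₀ • t = B4TorusKernel.translate M₀ z t`), `exists_translate_of_isPeriod`, `exists_rep_toT_eq_translate` (the box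
  representative `rep M (toT M z)` of pv09's torus dictionary is a translate of `z`), `tsum_translate_translate` (periodisations are shift-invariant along
  the period lattice), `dist_le_dist_translate`;
* §1 generic periodisation kit for a kernel `f : ℤ^{d+1} → ℝ` with `|f z| ≤ C·e^{−a·dist x₀ z}` along a period vector `M` (pv17's
  `MultiPeriod.translate M z m = z + M∘m`; re-centring `translate_translate` is b04's `B4Reflection242`): `abs_translate_le` (termwise, all `m`), `summable_translate`, `translate_tail_abs_le` /
  `tail_tsum_le` (for `M_i ≥ N ≥ 1`: `Σ'_{m ≠ 0} |f(z + M∘m)| ≤ C·K_{d+1}(a)·e^{a·dist x₀ z}·e^{−a(N−1)}`, PART 13's bound with `deltaZ_abs_le`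
  replaced by the hypothesis), `abs_tsum_translate_sub_le` (`|Σ'_m f(z + M∘m) − f z| ≤` the same);
* §2 **`eq_of_tsum_translate_eq`**: two such kernels whose periodisations agree along period vectors `M^{(N)}` with `min_i M^{(N)}_i ≥ N`
  for every `N` are EQUAL (`ge_of_tendsto`: the difference is bounded by tails `→ 0`); `Decay510` and scalar-period (`z + M₀•t`) adapters;
* §3 the `deltaZ` sockets: `deltaZ_eq_sub` (translation invariance), `abs_mul_deltaZ_col_le`, **`eq_mul_deltaZ_of_tsum_translate`**
  (`Σ'_m w(z + M∘m) = c·Σ'_m deltaZ L k (z + M∘m, κ) (0, l)` along `M → ∞` ⟹ `w z = c·deltaZ L k (z, κ) (0, l)` for all `z`),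
  `deltaPol_rep_eq_tsum_deltaZ` (PART 12 at ANY box representatives `p ≡ z`, `q ≡ 0 (mod M)`: `deltaPol M (L^k) (p,κ) (q,l) =
  Σ'_m deltaZ L k (z + M∘m, κ) (0, l)`), and the TORUS-REPRESENTATIVE socket **`eq_mul_deltaZ_of_deltaPol`** (hypothesis literally
  `Σ'_m w(z + M∘m) = c·deltaPol M (L^k) (rep(z mod M), κ) (rep(0 mod M), l)` along a sequence of tori), plus its scalar-period form
  **`eq_mul_deltaZ_of_deltaPol_scalar`** (`z + M₀ • t`, `M₀ → ∞`) and `eq_mul_deltaZ_of_deltaPol_scalar_decay510` (`Decay510` witness).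

USE (the S6-mm dictionary of row G-an2-4, swarm rows P1-L13b/L13c of `HOME/LEMMAS.md`; NOT asserted here): with `w := fun z => wΦ^{(N)} κ l z`
(`Beta/KernelSpecInstance.wΦ`, exponentially bounded by `KernelSpecInstance.decay_wΦ` = a `Decay510` witness, see `decay510_abs_le`) and the
torus identity `Σ_t wΦ^{(N)} κ l (z + M•t) = c_N·deltaPol M N ((z̄,κ),(0̄,l))` for all large `M` (row P1-L13b, to be proved by its owner),
`eq_mul_deltaZ_of_deltaPol_scalar_decay510 hδ (hdec κ l) L k κ l c_N M₁ (hL13b κ l) z` gives `wΦ^{(N)} κ l z = c_N·deltaZ L k ((z,κ),(0,l))`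
(`N = L^k`) — i.e. row P1-L13c modulo its units line (checked to elaborate against `decay_wΦ` in the seat's probe `probe_plug.lean`, not landed).
-/

namespace Summit.QuantumFields.BalabanUV.Beta.GAN24.DirichletExhaustionDeperiodise

open Filter Topology Finset Real
open Literature.MathematicalPhysics.QuantumFieldTheory.Balaban1983to89
open B4Sect5Proof (latticeConst latticeConst_nonneg latticeSum_le)
open B4TorusKernel.MultiPeriod (translate translate_apply translate_injective)
open B4Reflection242 (translate_translate)
open B6Lemma24Torus (pbox mem_pbox IsPeriod)
open B6LowerBound2153Torus (toT rep rep_mem_pbox isPeriod_rep_toT_sub)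
open B6Cov2156Torus (deltaPol)
open B4Sect5Exhaustion (K)
open B12Sec2to5 (l1 Decay510)
open Summit.QuantumFields.BalabanUV.Beta.GAN24.DirichletExhaustionDeltaZ (deltaZ c166Z kappaZ kappaZ_pos deltaZ_abs_le
  exp_l1_le_exp_dist)
open Summit.QuantumFields.BalabanUV.Beta.GAN24.DirichletExhaustionPeriodise (deltaPol_eq_tsum_deltaZ one_le_M)
open Summit.QuantumFields.BalabanUV.Beta.GAN24.DirichletExhaustionTails (dist_translate_ge summable_expDist)

noncomputable section

variable {d : ℕ}

/-! ## §0 Lattice bookkeeping: translates, shifts, representatives -/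

/-- `z + M∘0 = z`. -/
theorem translate_zero (M : Fin (d + 1) → ℕ) (z : Fin (d + 1) → ℤ) : translate M z 0 = z := by
  funext i; simp

/-- A scalar period `M₀` is the constant period vector: `translate (fun _ => M₀) z t = z + M₀ • t`. -/
theorem translate_const_eq_add_nsmul (M₀ : ℕ) (z t : Fin (d + 1) → ℤ) :
    translate (fun _ : Fin (d + 1) => M₀) z t = z + M₀ • t := by
  funext i; simp [nsmul_eq_mul]

/-- … and with the period read in `ℤ`: `translate (fun _ => M₀) z t = z + (M₀ : ℤ) • t`. -/
theorem translate_const_eq_add_zsmul (M₀ : ℕ) (z t : Fin (d + 1) → ℤ) :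
    translate (fun _ : Fin (d + 1) => M₀) z t = z + (M₀ : ℤ) • t := by
  funext i; simp [zsmul_eq_mul]

/-- pv17's scalar `B4TorusKernel.translate M₀` is the constant-vector `MultiPeriod.translate`. -/
theorem translate_const_eq_scalar (M₀ : ℕ) (z t : Fin (d + 1) → ℤ) :
    translate (fun _ : Fin (d + 1) => M₀) z t = B4TorusKernel.translate M₀ z t := rfl

/-- A difference which is a period is a translate: `IsPeriod M (y − x) → ∃ t, y = x + M∘t`. -/
theorem exists_translate_of_isPeriod {M : Fin (d + 1) → ℕ} {x y : Fin (d + 1) → ℤ} (h : IsPeriod M (y - x)) :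
    ∃ t : Fin (d + 1) → ℤ, y = translate M x t := by
  have h' : ∀ i, ∃ c : ℤ, y i - x i = (M i : ℤ) * c := fun i => h i
  choose t ht using h'
  refine ⟨t, funext fun i => ?_⟩
  have hi := ht i
  rw [translate_apply]
  linarith

/-- The box representative of `z mod M` is a translate of `z`. -/
theorem exists_rep_toT_eq_translate (M : Fin (d + 1) → ℕ) [∀ μ, NeZero (M μ)] (z : Fin (d + 1) → ℤ) :
    ∃ t : Fin (d + 1) → ℤ, rep M (toT M z) = translate M z t :=
  exists_translate_of_isPeriod (isPeriod_rep_toT_sub M z)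

/-- Periodisations are shift-invariant along the period lattice: `Σ'_m F((z + M∘t) + M∘m) = Σ'_m F(z + M∘m)`. -/
theorem tsum_translate_translate (M : Fin (d + 1) → ℕ) (F : (Fin (d + 1) → ℤ) → ℝ) (z t : Fin (d + 1) → ℤ) :
    ∑' m : Fin (d + 1) → ℤ, F (translate M (translate M z t) m) = ∑' m : Fin (d + 1) → ℤ, F (translate M z m) := by
  simp only [translate_translate]
  exact (Equiv.addLeft t).tsum_eq fun m => F (translate M z m)

/-! ## §1 Periodising an exponentially bounded kernel -/

section Generic

variable {f : (Fin (d + 1) → ℤ) → ℝ} {C a : ℝ} {x₀ : Fin (d + 1) → ℤ}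

/-- `dist 0 m ≤ dist z (z + M∘m)` when all `M_i ≥ 1`. -/
theorem dist_le_dist_translate {M : Fin (d + 1) → ℕ} (hM : ∀ i, 1 ≤ M i) (z m : Fin (d + 1) → ℤ) :
    dist (0 : Fin (d + 1) → ℤ) m ≤ dist z (translate M z m) := by
  refine (dist_pi_le_iff dist_nonneg).2 fun i => ?_
  refine le_trans ?_ (dist_le_pi_dist z (translate M z m) i)
  rw [Int.dist_eq, Int.dist_eq, Pi.zero_apply, translate_apply]
  have h1 : (1 : ℝ) ≤ (M i : ℝ) := by exact_mod_cast hM i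
  rw [Int.cast_zero, zero_sub, abs_neg, show ((z i : ℤ) : ℝ) - ((z i + (M i : ℤ) * m i : ℤ) : ℝ) = -((M i : ℝ) * (m i : ℝ)) by
    push_cast; ring, abs_neg, abs_mul, abs_of_nonneg (by positivity : (0 : ℝ) ≤ (M i : ℝ))]
  calc |((m i : ℤ) : ℝ)| = 1 * |((m i : ℤ) : ℝ)| := (one_mul _).symm
    _ ≤ (M i : ℝ) * |((m i : ℤ) : ℝ)| := mul_le_mul_of_nonneg_right h1 (abs_nonneg _)

/-- Termwise, ALL `m`: `|f(z + M∘m)| ≤ C·e^{a·dist x₀ z}·e^{−a·dist 0 m}` (triangle inequality; all `M_i ≥ 1`). -/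
theorem abs_translate_le (ha : 0 ≤ a) (hC : 0 ≤ C) (hf : ∀ z, |f z| ≤ C * Real.exp (-(a * dist x₀ z)))
    {M : Fin (d + 1) → ℕ} (hM : ∀ i, 1 ≤ M i) (z m : Fin (d + 1) → ℤ) :
    |f (translate M z m)| ≤ C * Real.exp (a * dist x₀ z) * Real.exp (-(a * dist (0 : Fin (d + 1) → ℤ) m)) := by
  refine (hf _).trans ?_
  have h1 := dist_le_dist_translate hM z m
  have h2 : dist z (translate M z m) ≤ dist z x₀ + dist x₀ (translate M z m) := dist_triangle _ _ _
  rw [dist_comm z x₀] at h2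
  rw [mul_assoc, ← Real.exp_add]
  refine mul_le_mul_of_nonneg_left (Real.exp_le_exp.mpr ?_) hC
  nlinarith

/-- The periodised family `m ↦ f(z + M∘m)` is summable (all `M_i ≥ 1`). -/
theorem summable_translate (ha : 0 < a) (hC : 0 ≤ C) (hf : ∀ z, |f z| ≤ C * Real.exp (-(a * dist x₀ z)))
    {M : Fin (d + 1) → ℕ} (hM : ∀ i, 1 ≤ M i) (z : Fin (d + 1) → ℤ) :
    Summable fun m : Fin (d + 1) → ℤ => f (translate M z m) := by
  obtain ⟨hs, -⟩ := summable_expDist (d := d) ha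
  refine (hs.mul_left (C * Real.exp (a * dist x₀ z))).of_norm_bounded fun m => ?_
  rw [Real.norm_eq_abs]
  exact abs_translate_le ha.le hC hf hM z m

/-- Termwise tail estimate: for `m ≠ 0` and periods `M_i ≥ N ≥ 1`,
`|f(z + M∘m)| ≤ C·e^{a·dist x₀ z}·e^{−a(N−1)}·e^{−a·dist 0 m}` (PART 13 `dist_translate_ge`). -/
theorem translate_tail_abs_le (ha : 0 < a) (hC : 0 ≤ C) (hf : ∀ z, |f z| ≤ C * Real.exp (-(a * dist x₀ z)))
    {M : Fin (d + 1) → ℕ} {N : ℕ} (hN : 1 ≤ N) (hMN : ∀ i, N ≤ M i) (z : Fin (d + 1) → ℤ) {m : Fin (d + 1) → ℤ}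
    (hm : m ≠ 0) :
    |f (translate M z m)| ≤ C * Real.exp (a * dist x₀ z) * Real.exp (-(a * ((N : ℝ) - 1))) *
        Real.exp (-(a * dist (0 : Fin (d + 1) → ℤ) m)) := by
  refine (hf _).trans ?_
  have hd := dist_translate_ge hN hMN x₀ z hm
  rw [dist_comm m 0] at hd
  rw [mul_assoc, mul_assoc, ← Real.exp_add, ← Real.exp_add]
  refine mul_le_mul_of_nonneg_left (Real.exp_le_exp.mpr ?_) hC
  nlinarith

/-- **The wrap-around tail** of the periodisation of `f`: for periods `M_i ≥ N ≥ 1` the family `m ≠ 0` is summable and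
`Σ'_{m ≠ 0} |f(z + M∘m)| ≤ C·K_{d+1}(a)·e^{a·dist x₀ z}·e^{−a(N−1)}`. -/
theorem tail_tsum_le (ha : 0 < a) (hC : 0 ≤ C) (hf : ∀ z, |f z| ≤ C * Real.exp (-(a * dist x₀ z)))
    {M : Fin (d + 1) → ℕ} {N : ℕ} (hN : 1 ≤ N) (hMN : ∀ i, N ≤ M i) (z : Fin (d + 1) → ℤ) :
    Summable (fun m : Fin (d + 1) → ℤ => if m = 0 then (0 : ℝ) else |f (translate M z m)|) ∧
    ∑' m : Fin (d + 1) → ℤ, (if m = 0 then (0 : ℝ) else |f (translate M z m)|) ≤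
      C * latticeConst (d + 1) a * Real.exp (a * dist x₀ z) * Real.exp (-(a * ((N : ℝ) - 1))) := by
  obtain ⟨hs, hle⟩ := summable_expDist (d := d) ha
  set W := C * Real.exp (a * dist x₀ z) * Real.exp (-(a * ((N : ℝ) - 1))) with hW
  have hW0 : 0 ≤ W := by rw [hW]; positivity
  have hterm : ∀ m : Fin (d + 1) → ℤ, (if m = 0 then (0 : ℝ) else |f (translate M z m)|) ≤
      W * Real.exp (-(a * dist (0 : Fin (d + 1) → ℤ) m)) := by
    intro m
    split_ifs with h
    · positivity
    · exact translate_tail_abs_le ha hC hf hN hMN z h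
  have hnn : ∀ m : Fin (d + 1) → ℤ, 0 ≤ (if m = 0 then (0 : ℝ) else |f (translate M z m)|) := by
    intro m; split_ifs <;> positivity
  have hsum : Summable fun m : Fin (d + 1) → ℤ => (if m = 0 then (0 : ℝ) else |f (translate M z m)|) :=
    (hs.mul_left W).of_nonneg_of_le hnn hterm
  refine ⟨hsum, ?_⟩
  calc ∑' m : Fin (d + 1) → ℤ, (if m = 0 then (0 : ℝ) else |f (translate M z m)|)
      ≤ ∑' m : Fin (d + 1) → ℤ, W * Real.exp (-(a * dist (0 : Fin (d + 1) → ℤ) m)) :=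
        hsum.tsum_le_tsum hterm (hs.mul_left W)
    _ = W * ∑' m : Fin (d + 1) → ℤ, Real.exp (-(a * dist (0 : Fin (d + 1) → ℤ) m)) := tsum_mul_left
    _ ≤ W * latticeConst (d + 1) a := mul_le_mul_of_nonneg_left hle hW0
    _ = C * latticeConst (d + 1) a * Real.exp (a * dist x₀ z) * Real.exp (-(a * ((N : ℝ) - 1))) := by
        rw [hW]; ring

/-- **Periodisation minus the `m = 0` term**: for periods `M_i ≥ N ≥ 1`,
`|Σ'_m f(z + M∘m) − f z| ≤ C·K_{d+1}(a)·e^{a·dist x₀ z}·e^{−a(N−1)}`. -/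
theorem abs_tsum_translate_sub_le (ha : 0 < a) (hC : 0 ≤ C) (hf : ∀ z, |f z| ≤ C * Real.exp (-(a * dist x₀ z)))
    {M : Fin (d + 1) → ℕ} {N : ℕ} (hN : 1 ≤ N) (hMN : ∀ i, N ≤ M i) (z : Fin (d + 1) → ℤ) :
    |∑' m : Fin (d + 1) → ℤ, f (translate M z m) - f z| ≤
      C * latticeConst (d + 1) a * Real.exp (a * dist x₀ z) * Real.exp (-(a * ((N : ℝ) - 1))) := by
  obtain ⟨hs, hle⟩ := tail_tsum_le ha hC hf hN hMN z
  set g : (Fin (d + 1) → ℤ) → ℝ := fun m => f (translate M z m) with hg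
  have hg0 : g 0 = f z := by simp only [hg, translate_zero]
  have hsplit : ∀ m, g m = (if m = 0 then g 0 else 0) + (if m = 0 then 0 else g m) := by
    intro m; split_ifs with h <;> simp [h]
  have htail_s : Summable fun m : Fin (d + 1) → ℤ => if m = 0 then (0 : ℝ) else g m := by
    refine hs.of_norm_bounded fun m => ?_
    simp only [hg]
    split_ifs <;> simp
  have hsingle_s : Summable fun m : Fin (d + 1) → ℤ => if m = 0 then g 0 else (0 : ℝ) :=
    summable_of_ne_finset_zero (s := {0}) (fun m hm => by rw [Finset.mem_singleton] at hm; rw [if_neg hm])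
  have hdecomp : ∑' m, g m = g 0 + ∑' m, (if m = 0 then (0 : ℝ) else g m) := by
    rw [show (∑' m, g m) = ∑' m, ((if m = 0 then g 0 else 0) + (if m = 0 then 0 else g m)) from tsum_congr hsplit,
      hsingle_s.tsum_add htail_s, tsum_ite_eq]
  change |∑' m, g m - f z| ≤ _
  rw [hdecomp, hg0, add_sub_cancel_left]
  have heq : (fun m : Fin (d + 1) → ℤ => |if m = 0 then (0 : ℝ) else g m|) =
      fun m => if m = 0 then (0 : ℝ) else |f (translate M z m)| := by
    funext m; split_ifs <;> simp [hg]
  have hnorm_s : Summable fun m : Fin (d + 1) → ℤ => ‖if m = 0 then (0 : ℝ) else g m‖ := by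
    simp only [Real.norm_eq_abs]; rw [heq]; exact hs
  have h1 : |∑' m, (if m = 0 then (0 : ℝ) else g m)| ≤ ∑' m, |if m = 0 then (0 : ℝ) else g m| := by
    have := norm_tsum_le_tsum_norm hnorm_s
    simpa only [Real.norm_eq_abs] using this
  refine h1.trans ?_
  rw [heq]
  exact hle

end Generic

/-! ## §2 Uniqueness: a kernel is determined by its periodisations along `M → ∞` -/

/-- The tail rate `e^{−a(N−1)} → 0` as `N → ∞` (`a > 0`). -/
theorem tendsto_exp_tail {a : ℝ} (ha : 0 < a) :
    Tendsto (fun N : ℕ => Real.exp (-(a * ((N : ℝ) - 1)))) atTop (𝓝 0) := by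
  have h1 : Tendsto (fun N : ℕ => a * ((N : ℝ) - 1)) atTop atTop := by
    refine Tendsto.const_mul_atTop ha ?_
    simpa only [sub_eq_add_neg] using tendsto_atTop_add_const_right atTop (-1 : ℝ) tendsto_natCast_atTop_atTop
  exact Real.tendsto_exp_neg_atTop_nhds_zero.comp h1

/-- **DE-PERIODISATION (uniqueness).**  Let `f, g : ℤ^{d+1} → ℝ` be exponentially bounded (`|f z| ≤ C_f·e^{−a_f·dist x_f z}`, likewise
`g`).  If for every `N` there is a period vector `M` with all `M_i ≥ N` along which the periodisations agree,
`Σ'_m f(z + M∘m) = Σ'_m g(z + M∘m)` for all `z`, then `f = g`. -/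
theorem eq_of_tsum_translate_eq {f g : (Fin (d + 1) → ℤ) → ℝ} {Cf af Cg ag : ℝ} {xf xg : Fin (d + 1) → ℤ}
    (haf : 0 < af) (hCf : 0 ≤ Cf) (hf : ∀ z, |f z| ≤ Cf * Real.exp (-(af * dist xf z)))
    (hag : 0 < ag) (hCg : 0 ≤ Cg) (hg : ∀ z, |g z| ≤ Cg * Real.exp (-(ag * dist xg z)))
    (h : ∀ N : ℕ, ∃ M : Fin (d + 1) → ℕ, (∀ i, N ≤ M i) ∧
      ∀ z, ∑' m : Fin (d + 1) → ℤ, f (translate M z m) = ∑' m : Fin (d + 1) → ℤ, g (translate M z m)) :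
    f = g := by
  funext z
  set Bf := Cf * latticeConst (d + 1) af * Real.exp (af * dist xf z) with hBf
  set Bg := Cg * latticeConst (d + 1) ag * Real.exp (ag * dist xg z) with hBg
  set b : ℕ → ℝ := fun N => Bf * Real.exp (-(af * ((N : ℝ) - 1))) + Bg * Real.exp (-(ag * ((N : ℝ) - 1))) with hb
  have hbound : ∀ N : ℕ, 1 ≤ N → |f z - g z| ≤ b N := by
    intro N hN
    obtain ⟨M, hMN, hM⟩ := h N
    have h1 := abs_tsum_translate_sub_le haf hCf hf hN hMN z
    have h2 := abs_tsum_translate_sub_le hag hCg hg hN hMN z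
    rw [hM z] at h1
    have h3 : f z - g z = (∑' m, g (translate M z m) - g z) - (∑' m, g (translate M z m) - f z) := by ring
    rw [h3]
    refine (abs_sub _ _).trans ?_
    rw [hb]
    linarith
  have htend : Tendsto b atTop (𝓝 0) := by
    have := ((tendsto_exp_tail haf).const_mul Bf).add ((tendsto_exp_tail hag).const_mul Bg)
    simpa [hb] using this
  have hle : |f z - g z| ≤ 0 := ge_of_tendsto htend (Filter.eventually_atTop.2 ⟨1, hbound⟩)
  exact sub_eq_zero.mp (abs_nonpos_iff.mp hle)

/-- `Decay510 f C δ` (the β-cell's `ℓ¹` currency, `|f z| ≤ C·e^{−δ|z|₁}`) gives the sup-distance bound used here, centred at `0`. -/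
theorem decay510_abs_le {f : (Fin (d + 1) → ℤ) → ℝ} {C δ : ℝ} (hδ : 0 ≤ δ) (hf : Decay510 f C δ) (z : Fin (d + 1) → ℤ) :
    |f z| ≤ C * Real.exp (-(δ * dist (0 : Fin (d + 1) → ℤ) z)) := by
  have hC : 0 ≤ C := by
    have h0 := hf 0
    have : l1 (0 : Fin (d + 1) → ℤ) = 0 := by simp [l1]
    rw [this, mul_zero, Real.exp_zero, mul_one] at h0
    exact (abs_nonneg _).trans h0
  refine (hf z).trans (mul_le_mul_of_nonneg_left ?_ hC)
  have h := exp_l1_le_exp_dist hδ z 0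
  rwa [sub_zero, dist_comm] at h

/-- `Decay510` witnesses have a nonnegative constant. -/
theorem decay510_const_nonneg {f : (Fin (d + 1) → ℤ) → ℝ} {C δ : ℝ} (hf : Decay510 f C δ) : 0 ≤ C := by
  have h0 := hf 0
  have : l1 (0 : Fin (d + 1) → ℤ) = 0 := by simp [l1]
  rw [this, mul_zero, Real.exp_zero, mul_one] at h0
  exact (abs_nonneg _).trans h0

/-! ## §3 The `deltaZ` sockets -/

/-- `deltaZ` is translation invariant: `deltaZ L k (x,α) (y,β) = deltaZ L k (x − y, α) (0, β)`. -/
theorem deltaZ_eq_sub (L : ℕ) [NeZero L] (k : ℕ) (x y : Fin (d + 1) → ℤ) (α β : Fin (d + 1)) :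
    deltaZ L k (x, α) (y, β) = deltaZ L k (x - y, α) (0, β) := by
  simp only [deltaZ, sub_zero]

/-- The multiplier column `z ↦ c·deltaZ L k (z,κ) (0,l)` is exponentially bounded: `≤ |c|·c166Z·e^{−κZ·dist 0 z}` (PART 8). -/
theorem abs_mul_deltaZ_col_le (L : ℕ) [NeZero L] (k : ℕ) (κ l : Fin (d + 1)) (c : ℝ) (z : Fin (d + 1) → ℤ) :
    |c * deltaZ L k (z, κ) (0, l)| ≤ |c| * c166Z d * Real.exp (-(kappaZ d * dist (0 : Fin (d + 1) → ℤ) z)) := by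
  rw [abs_mul, mul_assoc]
  refine mul_le_mul_of_nonneg_left ?_ (abs_nonneg c)
  have h := deltaZ_abs_le L k (z, κ) ((0 : Fin (d + 1) → ℤ), l)
  rwa [dist_comm] at h

/-- **SOCKET (periodised-`deltaZ` form).**  If `w : ℤ^{d+1} → ℝ` is exponentially bounded and, along period vectors `M → ∞`,
`Σ'_m w(z + M∘m) = c·Σ'_m deltaZ L k (z + M∘m, κ) (0, l)` for all `z`, then `w z = c·deltaZ L k (z, κ) (0, l)` for every `z`. -/
theorem eq_mul_deltaZ_of_tsum_translate {w : (Fin (d + 1) → ℤ) → ℝ} {C a : ℝ} {x₀ : Fin (d + 1) → ℤ} (ha : 0 < a) (hC : 0 ≤ C)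
    (hw : ∀ z, |w z| ≤ C * Real.exp (-(a * dist x₀ z))) (L : ℕ) [NeZero L] (k : ℕ) (κ l : Fin (d + 1)) (c : ℝ)
    (h : ∀ N : ℕ, ∃ M : Fin (d + 1) → ℕ, (∀ i, N ≤ M i) ∧
      ∀ z, ∑' m : Fin (d + 1) → ℤ, w (translate M z m) =
        c * ∑' m : Fin (d + 1) → ℤ, deltaZ L k (translate M z m, κ) (0, l)) (z : Fin (d + 1) → ℤ) :
    w z = c * deltaZ L k (z, κ) (0, l) := by
  have hc : 0 ≤ |c| * c166Z d := by
    have := B5Symbol166Strip.MG_pos (d + 1)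
    unfold c166Z; positivity
  have key := eq_of_tsum_translate_eq (g := fun z => c * deltaZ L k (z, κ) (0, l)) ha hC hw (kappaZ_pos d) hc
    (abs_mul_deltaZ_col_le L k κ l c) fun N => by
      obtain ⟨M, hMN, hM⟩ := h N
      exact ⟨M, hMN, fun z => by rw [hM z, ← tsum_mul_left]⟩
  exact congrFun key z

/-- **PART 12 at arbitrary representatives.**  For box points `p ≡ z` and `q ≡ 0 (mod M)`:
`deltaPol M (L^k) (p,κ) (q,l) = Σ'_m deltaZ L k (z + M∘m, κ) (0, l)`. -/
theorem deltaPol_rep_eq_tsum_deltaZ (M : Fin (d + 1) → ℕ) [∀ μ, NeZero (M μ)] (L : ℕ) [NeZero L] (k : ℕ) (κ l : Fin (d + 1))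
    {z : Fin (d + 1) → ℤ} {p q : ↥(pbox M)} (hp : IsPeriod M ((p : Fin (d + 1) → ℤ) - z))
    (hq : IsPeriod M ((q : Fin (d + 1) → ℤ) - 0)) :
    deltaPol M (L ^ k) (p, κ) (q, l) = ∑' m : Fin (d + 1) → ℤ, deltaZ L k (translate M z m, κ) (0, l) := by
  obtain ⟨s, hs⟩ := exists_translate_of_isPeriod hp
  obtain ⟨t, ht⟩ := exists_translate_of_isPeriod hq
  rw [deltaPol_eq_tsum_deltaZ M L k (p, κ) (q, l)]
  change ∑' m, deltaZ L k ((p : Fin (d + 1) → ℤ), κ) (translate M (q : Fin (d + 1) → ℤ) m, l) = _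
  rw [hs, ht]
  -- `deltaZ (z + M∘s, κ) ((0 + M∘t) + M∘m, l) = deltaZ (z + M∘(s − t − m), κ) (0, l)`; then re-index `m ↦ s − t − m`
  have hrew : ∀ m, deltaZ L k (translate M z s, κ) (translate M (translate M 0 t) m, l) =
      deltaZ L k (translate M z (s - t - m), κ) (0, l) := by
    intro m
    rw [deltaZ_eq_sub, deltaZ_eq_sub L k (translate M z (s - t - m))]
    congr 2
    funext i; simp only [Pi.sub_apply, translate_apply, Pi.zero_apply]; ring
  simp only [hrew]
  let e : (Fin (d + 1) → ℤ) ≃ (Fin (d + 1) → ℤ) :=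
    { toFun := fun m => s - t - m, invFun := fun m => s - t - m,
      left_inv := fun m => by simp, right_inv := fun m => by simp }
  exact e.tsum_eq fun m => deltaZ L k (translate M z m, κ) (0, l)

/-- **SOCKET (torus-representative form; the shape of swarm row P1-L13b).**  Let `w : ℤ^{d+1} → ℝ` be exponentially bounded and let
`M^{(N)}` be period vectors with all `M^{(N)}_i ≥ N`.  If for every `N` and `z` the periodisation of `w` along `M^{(N)}` equals
`c·deltaPol M^{(N)} (L^k)` at the box representatives of `z mod M` and `0 mod M`, then `w = c·deltaZ L k ((·,κ),(0,l))` on `ℤ^{d+1}`. -/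
theorem eq_mul_deltaZ_of_deltaPol {w : (Fin (d + 1) → ℤ) → ℝ} {C a : ℝ} {x₀ : Fin (d + 1) → ℤ} (ha : 0 < a) (hC : 0 ≤ C)
    (hw : ∀ z, |w z| ≤ C * Real.exp (-(a * dist x₀ z))) (L : ℕ) [NeZero L] (k : ℕ) (κ l : Fin (d + 1)) (c : ℝ)
    (M : ℕ → Fin (d + 1) → ℕ) [hM : ∀ N μ, NeZero (M N μ)] (hMN : ∀ N i, N ≤ M N i)
    (h : ∀ N z, ∑' m : Fin (d + 1) → ℤ, w (translate (M N) z m) =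
      c * deltaPol (M N) (L ^ k) (⟨rep (M N) (toT (M N) z), rep_mem_pbox (M N) _⟩, κ)
        (⟨rep (M N) (toT (M N) 0), rep_mem_pbox (M N) _⟩, l)) (z : Fin (d + 1) → ℤ) :
    w z = c * deltaZ L k (z, κ) (0, l) := by
  refine eq_mul_deltaZ_of_tsum_translate ha hC hw L k κ l c (fun N => ⟨M N, hMN N, fun z => ?_⟩) z
  rw [h N z, deltaPol_rep_eq_tsum_deltaZ (M N) L k κ l (isPeriod_rep_toT_sub (M N) z)]
  simpa only [sub_zero] using isPeriod_rep_toT_sub (M N) 0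

/-- **SOCKET (scalar periods, the literal P1-L13b/L13c shape).**  Let `w : ℤ^{d+1} → ℝ` be exponentially bounded.  If for all `M₀ ≥ M₁`
(scalar periods, `M₀ ≥ 1`) and all `z`,
`Σ'_t w(z + M₀ • t) = c·deltaPol (fun _ => M₀) (L^k) ((rep(z mod M₀), κ)) ((rep(0 mod M₀), l))`,
then `w z = c·deltaZ L k (z, κ) (0, l)` for every `z`. -/
theorem eq_mul_deltaZ_of_deltaPol_scalar {w : (Fin (d + 1) → ℤ) → ℝ} {C a : ℝ} {x₀ : Fin (d + 1) → ℤ} (ha : 0 < a)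
    (hC : 0 ≤ C) (hw : ∀ z, |w z| ≤ C * Real.exp (-(a * dist x₀ z))) (L : ℕ) [NeZero L] (k : ℕ) (κ l : Fin (d + 1)) (c : ℝ)
    (M₁ : ℕ) (h : ∀ (M₀ : ℕ) [NeZero M₀], M₁ ≤ M₀ → ∀ z : Fin (d + 1) → ℤ,
      ∑' t : Fin (d + 1) → ℤ, w (z + M₀ • t) =
        c * deltaPol (fun _ : Fin (d + 1) => M₀) (L ^ k)
          (⟨rep (fun _ : Fin (d + 1) => M₀) (toT (fun _ : Fin (d + 1) => M₀) z), rep_mem_pbox _ _⟩, κ)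
          (⟨rep (fun _ : Fin (d + 1) => M₀) (toT (fun _ : Fin (d + 1) => M₀) 0), rep_mem_pbox _ _⟩, l))
    (z : Fin (d + 1) → ℤ) :
    w z = c * deltaZ L k (z, κ) (0, l) := by
  haveI hI : ∀ N μ, NeZero ((fun (N : ℕ) (_ : Fin (d + 1)) => N + M₁ + 1) N μ) := fun N μ => ⟨by simp⟩
  refine eq_mul_deltaZ_of_deltaPol ha hC hw L k κ l c (fun N _ => N + M₁ + 1) (fun N i => show N ≤ N + M₁ + 1 by omega)
    (fun N z => ?_) z
  have hle : M₁ ≤ N + M₁ + 1 := by omega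
  rw [← h (N + M₁ + 1) hle z]
  simp only [translate_const_eq_add_nsmul]

/-- The same with a `Decay510` witness (the currency of `Beta/KernelSpecInstance.decay_wΦ`). -/
theorem eq_mul_deltaZ_of_deltaPol_scalar_decay510 {w : (Fin (d + 1) → ℤ) → ℝ} {C δ : ℝ} (hδ : 0 < δ) (hw : Decay510 w C δ)
    (L : ℕ) [NeZero L] (k : ℕ) (κ l : Fin (d + 1)) (c : ℝ) (M₁ : ℕ)
    (h : ∀ (M₀ : ℕ) [NeZero M₀], M₁ ≤ M₀ → ∀ z : Fin (d + 1) → ℤ,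
      ∑' t : Fin (d + 1) → ℤ, w (z + M₀ • t) =
        c * deltaPol (fun _ : Fin (d + 1) => M₀) (L ^ k)
          (⟨rep (fun _ : Fin (d + 1) => M₀) (toT (fun _ : Fin (d + 1) => M₀) z), rep_mem_pbox _ _⟩, κ)
          (⟨rep (fun _ : Fin (d + 1) => M₀) (toT (fun _ : Fin (d + 1) => M₀) 0), rep_mem_pbox _ _⟩, l))
    (z : Fin (d + 1) → ℤ) :
    w z = c * deltaZ L k (z, κ) (0, l) :=
  eq_mul_deltaZ_of_deltaPol_scalar hδ (decay510_const_nonneg hw) (decay510_abs_le hδ.le hw) L k κ l c M₁ h z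

end

end Summit.QuantumFields.BalabanUV.Beta.GAN24.DirichletExhaustionDeperiodise
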